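import Literature.Analysis.FluidPDE.PlanarCircleWirtinger
import Literature.Analysis.FluidPDE.GaussianVortexPlanarProofs
import HarnessLib

/-!
# ROAD (W) brick W-WIR, FILE 1∕2 (letters): Wirtinger on circles about a centre and the angular pairing `K(r)`

Cell `ym3-torus` (YM ladder rung R3 = continuum SU(2) Yang–Mills on T³ — a RUNG: NOT d = 4, NOT infinite volume, NOT a mass gap,
NOT the Clay problem), width seat `ym3-torus-px6` g10; `--supports stmt-QuantumFields-23533` (K2 lane, LINE 25, the (TM)∕(GAP)
discharge road); brick W-WIR of ★w3-19936 g16's ROAD (W) «H-system energy gap at exactly 3π from the sharp two-point Wente bound»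
(`ROAD-W-WENTE-3PI-w3g16.md` §2–§3).  Pure planar real analysis for `C¹` data (the road approximates Sobolev data at the 2-d level).

The one-dimensional inputs are ALREADY in the tree (Literature, proved): Wirtinger's inequality with the sharp constant
(`Literature.Analysis.FluidPDE.wirtinger_interval(_real)`), its circle form at the origin `circle_wirtinger_mean`, the circle
parametrisation `circlePt r θ = (r cos θ, r sin θ)` with velocity `perp (circlePt r θ)`, and polar coordinates on
`EuclideanSpace ℝ (Fin 2)` (`integral_eq_integral_circlePt`).  This file is the CENTRED ∕ ANNULAR ADAPTER the one-centre lemma (W-ONE)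
consumes, for `C¹` functions `g a b : EuclideanSpace ℝ (Fin 2) → ℝ`, a centre `x₀` and a radius `r` — FILE 1 (this file):

* §1 letters: a self-contained Cauchy–Schwarz inequality for interval integrals (continuous ∕ continuous-on-`[a,b]` data),
  `‖(circlePt r θ)^⊥‖ = |r|`, the angular derivative `∂_θ g := Dg(x₀ + ξ)[ξ^⊥]` (`ξ = circlePt r θ`) with `(∂_θ g)² ≤ r²‖Dg‖²`,
  `HasDerivAt` of the trace `θ ↦ g(x₀ + circlePt r θ)`, continuity in `(r, θ)`;
* §2 ★ `circle_wirtinger_mean_centre` — `∫_{-π}^{π} (g(x₀+ξ) − ḡ(r))² dθ ≤ ∫_{-π}^{π} (∂_θ g)² dθ` (sharp constant 1), and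
  ★ `abs_angularPairing_le` — `|K(r)| ≤ √(∫(∂_θ a)²)·√(∫(∂_θ b)²)` for `K(r) := ∫ (a(x₀+ξ) − ā(r))·∂_θ b dθ`; continuity in `r` of the
  angular energy, the circular mean and `K`;
* §4 circle-mean letters about `x₀` (the value `g x₀` at `r = 0`, `ḡ(r) → g x₀` as `r → 0`).
FILE 2 (`…PoincareLipschitzCircleWirtinger`) integrates in `dr∕r` over an annulus (polar coordinates) — the row under the road's boxed bound.

THEOREMS ONLY (0 `def`, 0 `sorry`, default heartbeats).  HONEST SCOPE: elementary letters; nothing of (W-ONE)∕(W-OSC)∕the (GAP)∕(TM),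
S1″, K1, `BlockLipschitzL`, `HistoryTailL`, R3, d = 4, a continuum limit or a mass gap is proved here; the Yang–Mills mass gap is NOT proved.

References: G. H. Hardy, J. E. Littlewood, G. Pólya, *Inequalities* (CUP 1952) §7.7 Thm 258 (Wirtinger) [HardyLittlewoodPolya1952];
F. Hélein, *Harmonic maps, conservation laws and moving frames* (CUP 2002) §3.1 (Wente's lemma by polar coordinates and Wirtinger)
[Helein2002]; P. Topping, The optimal constant in Wente's `L^∞` estimate, Comment. Math. Helv. 72 (1997) 316–328 [Topping1997].
-/

noncomputable section

open MeasureTheory Set Filter Real intervalIntegral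
open scoped Topology
open Literature.Analysis.FluidPDE

namespace Summit.QuantumFields.YangMills.Theorems.PoincareLipschitzCircleWirtinger

/-! ## §1 Letters -/

/-- Cauchy–Schwarz for interval integrals of continuous functions, in square-root form:
`|∫_a^b f·g| ≤ √(∫_a^b f²)·√(∫_a^b g²)` (`a ≤ b`).  [cite: HardyLittlewoodPolya1952, §6.5 Thm 181] -/
theorem abs_intervalIntegral_mul_le {f g : ℝ → ℝ} {a b : ℝ} (hab : a ≤ b) (hf : Continuous f) (hg : Continuous g) :
    |∫ x in a..b, f x * g x| ≤ √(∫ x in a..b, f x ^ 2) * √(∫ x in a..b, g x ^ 2) := by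
  set A := ∫ x in a..b, f x ^ 2 with hAdef
  set B := ∫ x in a..b, f x * g x with hBdef
  set C := ∫ x in a..b, g x ^ 2 with hCdef
  have hA0 : 0 ≤ A := intervalIntegral.integral_nonneg hab fun x _ => sq_nonneg _
  have hC0 : 0 ≤ C := intervalIntegral.integral_nonneg hab fun x _ => sq_nonneg _
  have hfi : IntervalIntegrable (fun x => f x ^ 2) volume a b := (hf.pow 2).intervalIntegrable _ _
  have hgi : IntervalIntegrable (fun x => g x ^ 2) volume a b := (hg.pow 2).intervalIntegrable _ _
  have hfgi : IntervalIntegrable (fun x => f x * g x) volume a b := (hf.mul hg).intervalIntegrable _ _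
  -- `∫ (t f ± g)² ≥ 0` gives `2|B| ≤ t A + C / t` for every `t > 0`
  have key : ∀ t : ℝ, 0 < t → 2 * |B| ≤ t * A + C / t := by
    intro t ht
    have hp : 0 ≤ ∫ x in a..b, (t * f x + g x) ^ 2 := intervalIntegral.integral_nonneg hab fun x _ => sq_nonneg _
    have hm : 0 ≤ ∫ x in a..b, (t * f x - g x) ^ 2 := intervalIntegral.integral_nonneg hab fun x _ => sq_nonneg _
    have ep : ∫ x in a..b, (t * f x + g x) ^ 2 = t ^ 2 * A + 2 * t * B + C := by
      have : (fun x => (t * f x + g x) ^ 2) = fun x => t ^ 2 * f x ^ 2 + 2 * t * (f x * g x) + g x ^ 2 := by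
        funext x; ring
      rw [this, intervalIntegral.integral_add ((hfi.const_mul _).add (hfgi.const_mul _)) hgi,
        intervalIntegral.integral_add (hfi.const_mul _) (hfgi.const_mul _), intervalIntegral.integral_const_mul,
        intervalIntegral.integral_const_mul]
    have em : ∫ x in a..b, (t * f x - g x) ^ 2 = t ^ 2 * A - 2 * t * B + C := by
      have : (fun x => (t * f x - g x) ^ 2) = fun x => t ^ 2 * f x ^ 2 - 2 * t * (f x * g x) + g x ^ 2 := by
        funext x; ring
      rw [this, intervalIntegral.integral_add ((hfi.const_mul _).sub (hfgi.const_mul _)) hgi,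
        intervalIntegral.integral_sub (hfi.const_mul _) (hfgi.const_mul _), intervalIntegral.integral_const_mul,
        intervalIntegral.integral_const_mul]
    rw [ep] at hp
    rw [em] at hm
    have hp' : 0 ≤ t * A + 2 * B + C / t := by
      have h := div_nonneg hp ht.le
      have e : (t ^ 2 * A + 2 * t * B + C) / t = t * A + 2 * B + C / t := by
        field_simp
      rw [e] at h
      exact h
    have hm' : 0 ≤ t * A - 2 * B + C / t := by
      have h := div_nonneg hm ht.le
      have e : (t ^ 2 * A - 2 * t * B + C) / t = t * A - 2 * B + C / t := by
        field_simp
      rw [e] at h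
      exact h
    calc 2 * |B| = |2 * B| := by rw [abs_mul, abs_two]
      _ ≤ t * A + C / t := abs_le.2 ⟨by linarith, by linarith⟩
  rcases eq_or_lt_of_le hA0 with hA | hA
  · -- `A = 0`: `2|B| ≤ C / t` for all `t > 0` forces `B = 0`
    have hB0 : |B| = 0 := by
      by_contra hne
      have hpos : 0 < |B| := lt_of_le_of_ne (abs_nonneg _) (Ne.symm hne)
      have h := key ((C + 1) / |B|) (div_pos (by linarith) hpos)
      rw [← hA, mul_zero, zero_add, div_div_eq_mul_div] at h
      have h' : C * |B| / (C + 1) ≤ |B| := by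
        rw [div_le_iff₀ (by linarith)]
        nlinarith
      linarith
    rw [hB0, ← hA, Real.sqrt_zero, zero_mul]
  rcases eq_or_lt_of_le hC0 with hC | hC
  · -- `C = 0`: `2|B| ≤ t A` for all `t > 0` forces `B = 0`
    have hB0 : |B| = 0 := by
      by_contra hne
      have hpos : 0 < |B| := lt_of_le_of_ne (abs_nonneg _) (Ne.symm hne)
      have h := key (|B| / (A + 1)) (div_pos hpos (by linarith))
      rw [← hC, zero_div, add_zero, div_mul_eq_mul_div] at h
      have h' : |B| * A / (A + 1) ≤ |B| := by
        rw [div_le_iff₀ (by linarith)]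
        nlinarith
      linarith
    rw [hB0, ← hC, Real.sqrt_zero, mul_zero]
  -- `A, C > 0`: take `t = √C / √A`
  have hsA := Real.sqrt_pos.2 hA
  have hsC := Real.sqrt_pos.2 hC
  have hAA := Real.mul_self_sqrt hA0
  have hCC := Real.mul_self_sqrt hC0
  have h := key (√C / √A) (div_pos hsC hsA)
  have e1 : √C / √A * A = √A * √C := by
    rw [div_mul_eq_mul_div, div_eq_iff hsA.ne']
    nlinarith
  have e2 : C / (√C / √A) = √A * √C := by
    rw [div_div_eq_mul_div, div_eq_iff hsC.ne']
    nlinarith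
  rw [e1, e2] at h
  linarith

/-- `‖ξ^⊥‖ = ‖ξ‖` for the planar rotation `perp` (re-export of lit `GaussianVortexPlanarProofs.norm_perp`). [folklore] -/
theorem norm_perp_circlePt (r θ : ℝ) : ‖perp (circlePt r θ)‖ = |r| := by
  rw [norm_perp, norm_circlePt]

/-- The angular derivative is dominated by the full gradient: `(Dg(y)[ξ^⊥])² ≤ r²·‖Dg(y)‖²` for `ξ = circlePt r θ`. [folklore] -/
theorem sq_fderiv_perp_le (g : EuclideanSpace ℝ (Fin 2) → ℝ) (y : EuclideanSpace ℝ (Fin 2)) (r θ : ℝ) :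
    (fderiv ℝ g y (perp (circlePt r θ))) ^ 2 ≤ r ^ 2 * ‖fderiv ℝ g y‖ ^ 2 := by
  have h := (fderiv ℝ g y).le_opNorm (perp (circlePt r θ))
  rw [norm_perp_circlePt, Real.norm_eq_abs] at h
  have h0 : 0 ≤ ‖fderiv ℝ g y‖ * |r| := by positivity
  calc (fderiv ℝ g y (perp (circlePt r θ))) ^ 2 = |fderiv ℝ g y (perp (circlePt r θ))| ^ 2 := (sq_abs _).symm
    _ ≤ (‖fderiv ℝ g y‖ * |r|) ^ 2 := pow_le_pow_left₀ (abs_nonneg _) h 2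
    _ = r ^ 2 * ‖fderiv ℝ g y‖ ^ 2 := by rw [mul_pow, sq_abs]; ring

/-- The translate `y ↦ g(x₀ + y)` of a `C¹` map is `C¹`. [folklore] -/
theorem contDiff_comp_add (x₀ : EuclideanSpace ℝ (Fin 2)) {g : EuclideanSpace ℝ (Fin 2) → ℝ} (hg : ContDiff ℝ 1 g) :
    ContDiff ℝ 1 fun y => g (x₀ + y) :=
  hg.comp (contDiff_const.add contDiff_id)

/-- The trace `θ ↦ g(x₀ + circlePt r θ)` of a differentiable `g` on the circle of radius `r` about `x₀` has derivative
`Dg(x₀ + ξ)[ξ^⊥]`. [folklore] -/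
theorem hasDerivAt_comp_centre_circlePt {g : EuclideanSpace ℝ (Fin 2) → ℝ} (hg : Differentiable ℝ g)
    (x₀ : EuclideanSpace ℝ (Fin 2)) (r θ : ℝ) :
    HasDerivAt (fun θ : ℝ => g (x₀ + circlePt r θ)) (fderiv ℝ g (x₀ + circlePt r θ) (perp (circlePt r θ))) θ := by
  have h := hasDerivAt_comp_circlePt (g := fun y => g (x₀ + y)) (hg.comp ((differentiable_const x₀).add differentiable_id)) r θ
  rwa [fderiv_comp_add_left] at h

/-- Joint continuity of `(r, θ) ↦ Dg(x₀ + circlePt r θ)[(circlePt r θ)^⊥]` for `g ∈ C¹`. [folklore] -/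
theorem continuous_fderiv_perp_uncurry {g : EuclideanSpace ℝ (Fin 2) → ℝ} (hg : ContDiff ℝ 1 g) (x₀ : EuclideanSpace ℝ (Fin 2)) :
    Continuous fun p : ℝ × ℝ => fderiv ℝ g (x₀ + circlePt p.1 p.2) (perp (circlePt p.1 p.2)) := by
  have hc : Continuous fun p : ℝ × ℝ => circlePt p.1 p.2 := continuous_circlePt_uncurry
  exact ((hg.continuous_fderiv one_ne_zero).comp (continuous_const.add hc)).clm_apply (continuous_perp.comp hc)

/-- Continuity in `θ` of the angular derivative at fixed radius. [folklore] -/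
theorem continuous_fderiv_perp {g : EuclideanSpace ℝ (Fin 2) → ℝ} (hg : ContDiff ℝ 1 g) (x₀ : EuclideanSpace ℝ (Fin 2)) (r : ℝ) :
    Continuous fun θ : ℝ => fderiv ℝ g (x₀ + circlePt r θ) (perp (circlePt r θ)) :=
  (continuous_fderiv_perp_uncurry hg x₀).comp (continuous_const.prodMk continuous_id)

/-- Continuity in `θ` of the trace at fixed radius. [folklore] -/
theorem continuous_comp_centre_circlePt {g : EuclideanSpace ℝ (Fin 2) → ℝ} (hg : Continuous g) (x₀ : EuclideanSpace ℝ (Fin 2)) (r : ℝ) :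
    Continuous fun θ : ℝ => g (x₀ + circlePt r θ) :=
  hg.comp (continuous_const.add (continuous_circlePt r))

/-! ## §2 Wirtinger on the circle of radius `r` about `x₀`, and the angular pairing `K(r)` -/

/-- ★ **Wirtinger on a circle about a centre, mean form (sharp constant 1)**: for `g ∈ C¹(ℝ²)`, a centre `x₀` and any radius `r`,
`∫_{-π}^{π} (g(x₀ + ξ) − ḡ(r))² dθ ≤ ∫_{-π}^{π} (Dg(x₀ + ξ)[ξ^⊥])² dθ`, `ξ = circlePt r θ`, `ḡ(r) = (2π)⁻¹∫ g(x₀ + circlePt r t) dt`.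
[cite: HardyLittlewoodPolya1952, §7.7 Thm 258] -/
theorem circle_wirtinger_mean_centre {g : EuclideanSpace ℝ (Fin 2) → ℝ} (hg : ContDiff ℝ 1 g) (x₀ : EuclideanSpace ℝ (Fin 2)) (r : ℝ) :
    ∫ θ in (-π)..π, (g (x₀ + circlePt r θ) - (2 * π)⁻¹ * ∫ t in (-π)..π, g (x₀ + circlePt r t)) ^ 2 ≤
      ∫ θ in (-π)..π, (fderiv ℝ g (x₀ + circlePt r θ) (perp (circlePt r θ))) ^ 2 := by
  have h := circle_wirtinger_mean (g := fun y => g (x₀ + y)) (contDiff_comp_add x₀ hg) r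
  simp only [fderiv_comp_add_left] at h
  exact h

/-- ★ **The angular pairing is bounded by the angular energies**: with `ξ = circlePt r θ`, `∂_θ a := Da(x₀+ξ)[ξ^⊥]`, `∂_θ b := Db(x₀+ξ)[ξ^⊥]`
and the circular mean `ā(r)`, `|∫_{-π}^{π} (a(x₀+ξ) − ā(r))·∂_θ b dθ| ≤ √(∫ (∂_θ a)²)·√(∫ (∂_θ b)²)` (Wirtinger + Cauchy–Schwarz; the constant
`ā(r)` is free because `∫ ∂_θ b dθ = 0` — W-ONE chooses it). [cite: Helein2002, §3.1] -/
theorem abs_angularPairing_le {a b : EuclideanSpace ℝ (Fin 2) → ℝ} (ha : ContDiff ℝ 1 a) (hb : ContDiff ℝ 1 b)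
    (x₀ : EuclideanSpace ℝ (Fin 2)) (r : ℝ) :
    |∫ θ in (-π)..π, (a (x₀ + circlePt r θ) - (2 * π)⁻¹ * ∫ t in (-π)..π, a (x₀ + circlePt r t)) *
        fderiv ℝ b (x₀ + circlePt r θ) (perp (circlePt r θ))| ≤
      √(∫ θ in (-π)..π, (fderiv ℝ a (x₀ + circlePt r θ) (perp (circlePt r θ))) ^ 2) *
        √(∫ θ in (-π)..π, (fderiv ℝ b (x₀ + circlePt r θ) (perp (circlePt r θ))) ^ 2) := by
  have hπ : -π ≤ π := by linarith [Real.pi_pos]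
  have hca : Continuous fun θ : ℝ => a (x₀ + circlePt r θ) - (2 * π)⁻¹ * ∫ t in (-π)..π, a (x₀ + circlePt r t) :=
    (continuous_comp_centre_circlePt ha.continuous x₀ r).sub continuous_const
  have h1 := abs_intervalIntegral_mul_le hπ hca (continuous_fderiv_perp hb x₀ r)
  refine h1.trans (mul_le_mul_of_nonneg_right (Real.sqrt_le_sqrt (circle_wirtinger_mean_centre ha x₀ r)) (Real.sqrt_nonneg _))

/-- Continuity in `r` of the angular energy `r ↦ ∫_{-π}^{π} (∂_θ g)² dθ`. [folklore] -/
theorem continuous_angularEnergy {g : EuclideanSpace ℝ (Fin 2) → ℝ} (hg : ContDiff ℝ 1 g) (x₀ : EuclideanSpace ℝ (Fin 2)) :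
    Continuous fun r : ℝ => ∫ θ in (-π)..π, (fderiv ℝ g (x₀ + circlePt r θ) (perp (circlePt r θ))) ^ 2 := by
  have h : Continuous (Function.uncurry fun (r θ : ℝ) => (fderiv ℝ g (x₀ + circlePt r θ) (perp (circlePt r θ))) ^ 2) :=
    (continuous_fderiv_perp_uncurry hg x₀).pow 2
  exact intervalIntegral.continuous_parametric_intervalIntegral_of_continuous' h (-π) π

/-- Continuity in `r` of the circular mean about `x₀`. [folklore] -/
theorem continuous_circleMean_centre {g : EuclideanSpace ℝ (Fin 2) → ℝ} (hg : Continuous g) (x₀ : EuclideanSpace ℝ (Fin 2)) :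
    Continuous fun r : ℝ => (2 * π)⁻¹ * ∫ t in (-π)..π, g (x₀ + circlePt r t) :=
  continuous_circleMean (g := fun y => g (x₀ + y)) (hg.comp (continuous_const.add continuous_id))

/-- Continuity in `r` of the angular pairing `K(r) = ∫ (a(x₀+ξ) − ā(r))·∂_θ b dθ`. [folklore] -/
theorem continuous_angularPairing {a b : EuclideanSpace ℝ (Fin 2) → ℝ} (ha : ContDiff ℝ 1 a) (hb : ContDiff ℝ 1 b)
    (x₀ : EuclideanSpace ℝ (Fin 2)) :
    Continuous fun r : ℝ => ∫ θ in (-π)..π, (a (x₀ + circlePt r θ) - (2 * π)⁻¹ * ∫ t in (-π)..π, a (x₀ + circlePt r t)) *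
      fderiv ℝ b (x₀ + circlePt r θ) (perp (circlePt r θ)) := by
  have hc : Continuous fun p : ℝ × ℝ => circlePt p.1 p.2 := continuous_circlePt_uncurry
  have h1 : Continuous fun p : ℝ × ℝ => a (x₀ + circlePt p.1 p.2) := ha.continuous.comp (continuous_const.add hc)
  have h2 : Continuous fun p : ℝ × ℝ => (2 * π)⁻¹ * ∫ t in (-π)..π, a (x₀ + circlePt p.1 t) :=
    (continuous_circleMean_centre ha.continuous x₀).comp continuous_fst
  have h : Continuous (Function.uncurry fun (r θ : ℝ) =>
      (a (x₀ + circlePt r θ) - (2 * π)⁻¹ * ∫ t in (-π)..π, a (x₀ + circlePt r t)) * fderiv ℝ b (x₀ + circlePt r θ) (perp (circlePt r θ))) :=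
    (h1.sub h2).mul (continuous_fderiv_perp_uncurry hb x₀)
  exact intervalIntegral.continuous_parametric_intervalIntegral_of_continuous' h (-π) π

/-- Cauchy–Schwarz for interval integrals of functions continuous on `[a, b]` (square-root form). [cite: HardyLittlewoodPolya1952, §6.5 Thm 181] -/
theorem abs_intervalIntegral_mul_le_of_continuousOn {f g : ℝ → ℝ} {a b : ℝ} (hab : a ≤ b) (hf : ContinuousOn f (Icc a b))
    (hg : ContinuousOn g (Icc a b)) :
    |∫ x in a..b, f x * g x| ≤ √(∫ x in a..b, f x ^ 2) * √(∫ x in a..b, g x ^ 2) := by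
  -- extend `f, g` continuously from `[a, b]` to `ℝ` by clamping the argument
  set F : ℝ → ℝ := fun x => f (max a (min b x)) with hF
  set G : ℝ → ℝ := fun x => g (max a (min b x)) with hG
  have hcl : Continuous fun x : ℝ => max a (min b x) := continuous_const.max (continuous_const.min continuous_id)
  have hmem : ∀ x : ℝ, max a (min b x) ∈ Icc a b := fun x => ⟨le_max_left _ _, max_le hab (min_le_left _ _)⟩
  have hFc : Continuous F := hf.comp_continuous hcl hmem
  have hGc : Continuous G := hg.comp_continuous hcl hmem
  have heq : ∀ x ∈ Icc a b, max a (min b x) = x := fun x hx => by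
    rw [min_eq_right hx.2, max_eq_right hx.1]
  have e1 : ∫ x in a..b, f x * g x = ∫ x in a..b, F x * G x :=
    intervalIntegral.integral_congr fun x hx => by
      rw [uIcc_of_le hab] at hx; simp only [hF, hG, heq x hx]
  have e2 : ∫ x in a..b, f x ^ 2 = ∫ x in a..b, F x ^ 2 :=
    intervalIntegral.integral_congr fun x hx => by
      rw [uIcc_of_le hab] at hx; simp only [hF, heq x hx]
  have e3 : ∫ x in a..b, g x ^ 2 = ∫ x in a..b, G x ^ 2 :=
    intervalIntegral.integral_congr fun x hx => by
      rw [uIcc_of_le hab] at hx; simp only [hG, heq x hx]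
  rw [e1, e2, e3]
  exact abs_intervalIntegral_mul_le hab hFc hGc

/-! ## §4 Circle-mean letters about a centre -/

/-- At radius `0` the circular mean about `x₀` is `g x₀`. [folklore] -/
theorem circleMean_centre_zero (g : EuclideanSpace ℝ (Fin 2) → ℝ) (x₀ : EuclideanSpace ℝ (Fin 2)) :
    (2 * π)⁻¹ * ∫ t in (-π)..π, g (x₀ + circlePt 0 t) = g x₀ := by
  simp only [circlePt_zero_left, add_zero, intervalIntegral.integral_const, smul_eq_mul]
  have hπ : π ≠ 0 := Real.pi_ne_zero
  field_simp
  ring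

/-- The circular mean about `x₀` tends to `g x₀` as `r → 0` (continuity of a continuous `g`). [folklore] -/
theorem tendsto_circleMean_centre {g : EuclideanSpace ℝ (Fin 2) → ℝ} (hg : Continuous g) (x₀ : EuclideanSpace ℝ (Fin 2)) :
    Tendsto (fun r : ℝ => (2 * π)⁻¹ * ∫ t in (-π)..π, g (x₀ + circlePt r t)) (𝓝 0) (𝓝 (g x₀)) := by
  have h := (continuous_circleMean_centre hg x₀).tendsto 0
  rwa [circleMean_centre_zero] at h


end Summit.QuantumFields.YangMills.Theorems.PoincareLipschitzCircleWirtinger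

end
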